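import Summits.CriticalPhenomena.PercolationContinuityZ3.Theorems.PercNearOneGluingNoHeavyQuantBinomialBlobsHeavy
import HarnessLib

/-!
# QUANT lane R8, T-DEC: the POISSON-BINOMIAL TOOLKIT of the equal-size blob law — slices commute, ratio monotonicity for gates `≥ 1/2`,
# the size-bias (leave-one-out) identities, common remainders (prim-quant-census-2 gen 82, file 1 of 2)

builds on p205010 (kernel theorem, internal audit signed; external expert review pending)

Support file (`--supports stmt-CriticalPhenomena-4575`), QUANT lane census seat prim-quant-census-2 (gen 82); memo
`run/shared/lean/prim/quant/prim-quant-census-2-g82/REFLECTION-G82.md`.  Theorems only, standard axioms, no sorries, no definitions.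
Consumer: `…QuantReflectionGates` (n equal blobs with ARBITRARY gates `gᵢ ∈ [1/2,1)` are heavy at their average gate, every `n` — the
general-gates reflection capacity of conjecture BLOB-AFL, `…/prim-quant-census-2-g80/TRIPLE-G80.md` §5, memo AFL-G81 §2/§5).

Write `P_G(j)` for the Poisson-binomial point mass of the gate list `G` (`n = |G|`): `blobLaw (G.map (k, ·)) (j·k)`, the law of `n` blobs of the
common size `k ≥ 1` at the atom `j·k`.
* `slice_comm`, **`blobLaw_perm`** — one-blob slices commute; the blob law of a list depends on it only up to permutation.
* `pb_cons_zero`, `pb_cons_succ` — the recursion `P_{a::G}(0) = (1−a)P_G(0)`, `P_{a::G}(j+1) = (1−a)P_G(j+1) + a·P_G(j)`; `blobTop_blobs = n·k`,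
  `blobMean_blobs = k·ΣG`.
* **`pb_ratio_mono`** — for gates in `[1/2, 1]` and every `i`: **`(n − i)·P_G(i) ≤ (i + 1)·P_G(i+1)`**, i.e. `i ↦ P_G(i)/C(n,i)` is non-decreasing
  (list induction; the step uses only `1 − a ≤ a`); iterated form `pb_choose_mono`: `C(n,i')·P_G(i) ≤ C(n,i)·P_G(i')` for `i ≤ i'`.
* **`pb_size_bias_succ`**, **`pb_size_bias_fail`** — the leave-one-out identities `Σ_m g_m·P_{G∖m}(i) = (i+1)·P_G(i+1)` and
  `Σ_m (1 − g_m)·P_{G∖m}(i) = (n − i)·P_G(i)` (`G∖m = G.eraseIdx m`; every gate list, list induction).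
* `perm_get_cons_eraseIdx`, **`exists_common_remainder`** — `G ~ g_i :: G∖i`; for indices `m ≠ l` there is a common remainder `W` (entries of `G`,
  `|W| = n − 2`) with `G∖m ~ g_l :: W` and `G∖l ~ g_m :: W`.

HONEST STATUS.  Tool; `SiblingStep`, `FarTreeRow`, `GluedLemmaW`, `GluedDominatedMass` OPEN; RATE class (log\*) / honest sentence of
`run/shared/lean/prim/quant/README.md` unchanged.  [this work]; the size-bias identity is classical [folklore].  Nothing here is cited as a
published result.  The gluing rows served [cite: KozmaNitzan2024, Conjecture 3 (p. 15)]; product measure [cite: Grimmett1999, §1.3 p. 10].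
-/

noncomputable section

open scoped BigOperators

namespace Summit.CriticalPhenomena.PercolationContinuityZ3.Theorems
namespace Quant

open Finset

/-- the two-point law `{lo, hi; g}` (as in `…QuantLawDEC`) -/
local notation3 "TP[" lo ", " hi ", " g ", " h "]" =>
  (g : ℝ) * (if (h : ℕ) = (hi : ℕ) then (1 : ℝ) else 0) + (1 - (g : ℝ)) * (if (h : ℕ) = (lo : ℕ) then (1 : ℝ) else 0)

/-- the Poisson-binomial point mass `P_G(j)`: the law of the blobs `(k, g)`, `g ∈ G`, at the atom `j·k` -/
local notation3 "PB[" k ", " G ", " j "]" => LawDec.blobLaw (List.map (fun g : ℝ => ((k : ℕ), g)) G) ((j : ℕ) * (k : ℕ))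

namespace LawDec

/-! ### Slices commute; the blob law is permutation invariant -/

/-- two one-blob slices commute. [this work] -/
theorem slice_comm (μ : ℕ → ℝ) (a b : ℕ) (g h : ℝ) : slice (slice μ a g) b h = slice (slice μ b h) a g := by
  funext n
  simp only [slice]
  split_ifs <;> first
    | ring1
    | (exfalso; omega)
    | (rw [Nat.sub_right_comm]; ring1)

/-- the blob law depends on the blob list only up to permutation. [this work] -/
theorem blobLaw_perm {l₁ l₂ : List (ℕ × ℝ)} (h : l₁.Perm l₂) : blobLaw l₁ = blobLaw l₂ := by
  induction h with
  | nil => rfl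
  | cons p _ ih => show slice (blobLaw _) p.1 p.2 = slice (blobLaw _) p.1 p.2; rw [ih]
  | swap p q l => exact slice_comm (blobLaw l) p.1 q.1 p.2 q.2
  | trans _ _ ih1 ih2 => exact ih1.trans ih2

/-! ### The Poisson-binomial recursion at the multiples of `k` -/

/-- no blobs: mass `1` at `0`. [this work] -/
theorem pb_nil_zero (k : ℕ) : PB[k, [], 0] = 1 := by
  simp [blobLaw]

/-- no blobs: no mass at `(j+1)·k`, `k ≥ 1` (plain form). [this work] -/
theorem blobLaw_nil_succ_mul (k : ℕ) (hk : 0 < k) (j : ℕ) : blobLaw [] ((j + 1) * k) = 0 := by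
  simp only [blobLaw]
  rw [if_neg (Nat.mul_pos (Nat.succ_pos j) hk).ne']

/-- no blobs: no mass at `(j+1)·k`, `k ≥ 1`. [this work] -/
theorem pb_nil_succ (k : ℕ) (hk : 0 < k) (j : ℕ) : PB[k, [], j + 1] = 0 := by
  rw [List.map_nil]; exact blobLaw_nil_succ_mul k hk j

/-- head blob at the atom `0`: `P_{a::G}(0) = (1−a)·P_G(0)` (`k ≥ 1`). [this work] -/
theorem pb_cons_zero (k : ℕ) (hk : 0 < k) (a : ℝ) (G : List ℝ) : PB[k, a :: G, 0] = (1 - a) * PB[k, G, 0] := by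
  simp only [List.map_cons, blobLaw, slice, Nat.zero_mul]
  rw [if_neg (by omega), mul_zero, add_zero]

/-- head blob at the atom `(j+1)·k`: `P_{a::G}(j+1) = (1−a)·P_G(j+1) + a·P_G(j)`. [this work] -/
theorem pb_cons_succ (k : ℕ) (a : ℝ) (G : List ℝ) (j : ℕ) :
    PB[k, a :: G, j + 1] = (1 - a) * PB[k, G, j + 1] + a * PB[k, G, j] := by
  simp only [List.map_cons, blobLaw, slice]
  rw [if_pos (by rw [Nat.succ_mul]; exact Nat.le_add_left k (j * k)),
    show (j + 1) * k - k = j * k by rw [Nat.succ_mul, Nat.add_sub_cancel]]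

/-- gates of the blob list `(k, g)`, `g ∈ G`, lie in `[0,1]` when those of `G` do. [this work] -/
theorem blobs_gates_mem (k : ℕ) (G : List ℝ) (hG : ∀ g ∈ G, 0 ≤ g ∧ g ≤ 1) :
    ∀ p ∈ List.map (fun g : ℝ => (k, g)) G, 0 ≤ p.2 ∧ p.2 ≤ 1 := by
  intro p hp
  obtain ⟨g, hg, rfl⟩ := List.mem_map.1 hp
  exact hG g hg

/-- `P_G(j) ≥ 0` for gates in `[0,1]`. [this work] -/
theorem pb_nonneg (k : ℕ) (G : List ℝ) (hG : ∀ g ∈ G, 0 ≤ g ∧ g ≤ 1) (j : ℕ) : 0 ≤ PB[k, G, j] :=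
  blobLaw_nonneg _ (blobs_gates_mem k G hG) _

/-- top of the blob list `(k, g)`, `g ∈ G`: `|G|·k`. [this work] -/
theorem blobTop_blobs (k : ℕ) : ∀ G : List ℝ, blobTop (List.map (fun g : ℝ => (k, g)) G) = G.length * k
  | [] => by simp [blobTop]
  | a :: G => by rw [List.map_cons]; simp only [blobTop, List.length_cons]; rw [blobTop_blobs k G]; ring

/-- mean of the blob list `(k, g)`, `g ∈ G`: `k·ΣG`. [this work] -/
theorem blobMean_blobs (k : ℕ) : ∀ G : List ℝ, blobMean (List.map (fun g : ℝ => (k, g)) G) = (k : ℝ) * G.sum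
  | [] => by simp [blobMean]
  | a :: G => by rw [List.map_cons]; simp only [blobMean, List.sum_cons]; rw [blobMean_blobs k G]; ring

/-! ### Ratio monotonicity: `P_G(i)/C(n,i)` is non-decreasing when every gate is `≥ 1/2` -/

/-- **RATIO MONOTONICITY.** For gates in `[1/2, 1]` and every `i`: `(n − i)·P_G(i) ≤ (i + 1)·P_G(i+1)` (`n = |G|`), i.e.
`i ↦ P_G(i)/C(n,i)` is non-decreasing.  List induction; the step uses only `1 − a ≤ a`. [this work] -/
theorem pb_ratio_mono (k : ℕ) (hk : 0 < k) : ∀ (G : List ℝ), (∀ g ∈ G, 1 / 2 ≤ g ∧ g ≤ 1) →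
    ∀ i : ℕ, ((G.length : ℝ) - i) * PB[k, G, i] ≤ ((i : ℝ) + 1) * PB[k, G, i + 1]
  | [], _, i => by
    rw [pb_nil_succ k hk]
    cases i with
    | zero => simp
    | succ i => rw [pb_nil_succ k hk]; simp
  | a :: G, hG, i => by
    have ha := hG a (by simp)
    have hG' : ∀ g ∈ G, 1 / 2 ≤ g ∧ g ≤ 1 := fun g hg => hG g (List.mem_cons_of_mem a hg)
    have hG0 : ∀ g ∈ G, 0 ≤ g ∧ g ≤ 1 := fun g hg => ⟨by linarith [(hG' g hg).1], (hG' g hg).2⟩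
    have hnn := pb_nonneg k G hG0
    rw [List.length_cons]
    push_cast
    cases i with
    | zero =>
      rw [pb_cons_zero k hk, pb_cons_succ]
      have ih := pb_ratio_mono k hk G hG' 0
      have h0 := hnn 0
      simp only [Nat.cast_zero, sub_zero, zero_add, one_mul, Nat.zero_mul] at ih h0 ⊢
      nlinarith [mul_nonneg (by linarith : (0 : ℝ) ≤ 1 - a) (sub_nonneg.2 ih), mul_nonneg (by linarith : (0 : ℝ) ≤ 2 * a - 1) h0]
    | succ i =>
      rw [pb_cons_succ, pb_cons_succ]
      have ih1 := pb_ratio_mono k hk G hG' (i + 1)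
      have ih0 := pb_ratio_mono k hk G hG' i
      push_cast at ih1 ih0 ⊢
      nlinarith [mul_nonneg (by linarith : (0 : ℝ) ≤ 1 - a) (sub_nonneg.2 ih1),
        mul_nonneg (by linarith : (0 : ℝ) ≤ a) (sub_nonneg.2 ih0),
        mul_nonneg (by linarith : (0 : ℝ) ≤ 2 * a - 1) (hnn (i + 1))]

/-- iterated: for `i ≤ i'`, `C(n,i')·P_G(i) ≤ C(n,i)·P_G(i')`. [this work] -/
theorem pb_choose_mono (k : ℕ) (hk : 0 < k) (G : List ℝ) (hG : ∀ g ∈ G, 1 / 2 ≤ g ∧ g ≤ 1) (i : ℕ) :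
    ∀ d : ℕ, (G.length.choose (i + d) : ℝ) * PB[k, G, i] ≤ (G.length.choose i : ℝ) * PB[k, G, i + d]
  | 0 => by simp
  | d + 1 => by
    have hG0 : ∀ g ∈ G, 0 ≤ g ∧ g ≤ 1 := fun g hg => ⟨by linarith [(hG g hg).1], (hG g hg).2⟩
    have ih := pb_choose_mono k hk G hG i d
    have hr := pb_ratio_mono k hk G hG (i + d)
    set n := G.length with hn
    rcases lt_or_ge (i + d) n with hlt | hge
    · -- `C(n, i+d+1)·(i+d+1) = C(n, i+d)·(n − i − d)`
      have hc : (n.choose (i + d + 1) : ℝ) * ((i + d : ℕ) + 1) = (n.choose (i + d) : ℝ) * ((n : ℝ) - (i + d : ℕ)) := by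
        have h := Nat.choose_succ_right_eq n (i + d)
        rw [← Nat.cast_sub hlt.le]
        exact_mod_cast h
      have hpos : (0 : ℝ) < (i + d : ℕ) + 1 := by positivity
      have hCi : (0 : ℝ) ≤ (n.choose i : ℝ) := by positivity
      -- multiply the target by `(i+d+1) > 0`
      have key : (n.choose (i + d + 1) : ℝ) * ((i + d : ℕ) + 1) * PB[k, G, i]
          ≤ (n.choose i : ℝ) * (((i + d : ℕ) + 1) * PB[k, G, i + d + 1]) := by
        rw [hc]
        have hnd : (0 : ℝ) ≤ (n : ℝ) - (i + d : ℕ) := by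
          rw [sub_nonneg]; exact_mod_cast hlt.le
        calc (n.choose (i + d) : ℝ) * ((n : ℝ) - (i + d : ℕ)) * PB[k, G, i]
            = ((n : ℝ) - (i + d : ℕ)) * ((n.choose (i + d) : ℝ) * PB[k, G, i]) := by ring
          _ ≤ ((n : ℝ) - (i + d : ℕ)) * ((n.choose i : ℝ) * PB[k, G, i + d]) := mul_le_mul_of_nonneg_left ih hnd
          _ = (n.choose i : ℝ) * (((n : ℝ) - (i + d : ℕ)) * PB[k, G, i + d]) := by ring
          _ ≤ (n.choose i : ℝ) * (((i + d : ℕ) + 1) * PB[k, G, i + d + 1]) := mul_le_mul_of_nonneg_left hr hCi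
      rw [show i + (d + 1) = i + d + 1 by ring]
      have := key
      nlinarith [pb_nonneg k G hG0 i, pb_nonneg k G hG0 (i + d + 1)]
    · rw [Nat.choose_eq_zero_of_lt (by omega : n < i + (d + 1))]
      simp only [Nat.cast_zero, zero_mul]
      exact mul_nonneg (by positivity) (pb_nonneg k G hG0 _)

/-! ### The size-bias identities (leave-one-out) -/

/-- **SIZE BIAS (successes).** `Σ_m g_m·P_{G∖m}(i) = (i+1)·P_G(i+1)`. [this work] -/
theorem pb_size_bias_succ (k : ℕ) (hk : 0 < k) : ∀ (G : List ℝ) (i : ℕ),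
    ∑ m : Fin G.length, G.get m * PB[k, G.eraseIdx m, i] = ((i : ℝ) + 1) * PB[k, G, i + 1]
  | [], i => by simp [blobLaw_nil_succ_mul k hk]
  | a :: G, i => by
    show ∑ m : Fin (G.length + 1), (a :: G).get m * PB[k, (a :: G).eraseIdx m, i] = _
    rw [Fin.sum_univ_succ]
    have e : ∀ m : Fin G.length, (a :: G).get m.succ * PB[k, (a :: G).eraseIdx (m.succ : ℕ), i]
        = G.get m * PB[k, a :: G.eraseIdx m, i] := fun m => by simp
    simp only [e]
    have e0 : (a :: G).get (0 : Fin (G.length + 1)) = a := rfl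
    have e0' : (a :: G).eraseIdx ((0 : Fin (G.length + 1)) : ℕ) = G := rfl
    rw [e0, e0']
    cases i with
    | zero =>
      rw [pb_cons_succ]
      simp only [pb_cons_zero k hk]
      have e1 : ∀ m : Fin G.length, G.get m * ((1 - a) * PB[k, G.eraseIdx m, 0]) = (1 - a) * (G.get m * PB[k, G.eraseIdx m, 0]) :=
        fun m => by ring
      simp only [e1]
      rw [← Finset.mul_sum, pb_size_bias_succ k hk G 0]
      ring
    | succ i =>
      simp only [pb_cons_succ]
      have e1 : ∀ m : Fin G.length, G.get m * ((1 - a) * PB[k, G.eraseIdx m, i + 1] + a * PB[k, G.eraseIdx m, i])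
          = (1 - a) * (G.get m * PB[k, G.eraseIdx m, i + 1]) + a * (G.get m * PB[k, G.eraseIdx m, i]) := fun m => by ring
      simp only [e1]
      rw [Finset.sum_add_distrib, ← Finset.mul_sum, ← Finset.mul_sum, pb_size_bias_succ k hk G (i + 1),
        pb_size_bias_succ k hk G i]
      push_cast
      ring

/-- **SIZE BIAS (failures).** `Σ_m (1 − g_m)·P_{G∖m}(i) = (n − i)·P_G(i)`. [this work] -/
theorem pb_size_bias_fail (k : ℕ) (hk : 0 < k) : ∀ (G : List ℝ) (i : ℕ),
    ∑ m : Fin G.length, (1 - G.get m) * PB[k, G.eraseIdx m, i] = ((G.length : ℝ) - i) * PB[k, G, i]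
  | [], i => by
    cases i with
    | zero => simp
    | succ i => simp [blobLaw_nil_succ_mul k hk]
  | a :: G, i => by
    show ∑ m : Fin (G.length + 1), (1 - (a :: G).get m) * PB[k, (a :: G).eraseIdx m, i]
      = (((G.length + 1 : ℕ) : ℝ) - i) * _
    rw [Fin.sum_univ_succ]
    have e : ∀ m : Fin G.length, (1 - (a :: G).get m.succ) * PB[k, (a :: G).eraseIdx (m.succ : ℕ), i]
        = (1 - G.get m) * PB[k, a :: G.eraseIdx m, i] := fun m => by simp
    simp only [e]
    have e0 : (a :: G).get (0 : Fin (G.length + 1)) = a := rfl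
    have e0' : (a :: G).eraseIdx ((0 : Fin (G.length + 1)) : ℕ) = G := rfl
    rw [e0, e0']
    cases i with
    | zero =>
      simp only [pb_cons_zero k hk, Nat.cast_zero, sub_zero]
      have e1 : ∀ m : Fin G.length, (1 - G.get m) * ((1 - a) * PB[k, G.eraseIdx m, 0])
          = (1 - a) * ((1 - G.get m) * PB[k, G.eraseIdx m, 0]) := fun m => by ring
      simp only [e1]
      rw [← Finset.mul_sum, pb_size_bias_fail k hk G 0]
      push_cast
      ring
    | succ i =>
      simp only [pb_cons_succ]
      have e1 : ∀ m : Fin G.length, (1 - G.get m) * ((1 - a) * PB[k, G.eraseIdx m, i + 1] + a * PB[k, G.eraseIdx m, i])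
          = (1 - a) * ((1 - G.get m) * PB[k, G.eraseIdx m, i + 1]) + a * ((1 - G.get m) * PB[k, G.eraseIdx m, i]) :=
        fun m => by ring
      simp only [e1]
      rw [Finset.sum_add_distrib, ← Finset.mul_sum, ← Finset.mul_sum, pb_size_bias_fail k hk G (i + 1),
        pb_size_bias_fail k hk G i]
      push_cast
      ring


/-! ### Two leave-one-out lists share a common remainder -/

/-- a list is a permutation of its `i`-th entry consed onto the list with that entry erased. [folklore] -/
theorem perm_get_cons_eraseIdx {α : Type*} : ∀ (l : List α) (i : Fin l.length), l.Perm (l.get i :: l.eraseIdx i)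
  | [], i => i.elim0
  | a :: l, ⟨0, _⟩ => List.Perm.refl _
  | a :: l, ⟨i + 1, h⟩ => by
    have h' : i < l.length := by simpa using h
    have ih := perm_get_cons_eraseIdx l ⟨i, h'⟩
    show (a :: l).Perm (l.get ⟨i, h'⟩ :: a :: l.eraseIdx i)
    exact (ih.cons a).trans (List.Perm.swap (l.get ⟨i, h'⟩) a (l.eraseIdx i))

/-- **two leave-one-out lists share a common remainder**: for indices `m ≠ j` of `l` there is a list `W` of entries of `l`, of length
`|l| − 2`, with `l∖m ~ l_j :: W` and `l∖j ~ l_m :: W`. [folklore] -/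
theorem exists_common_remainder {α : Type*} : ∀ (l : List α) (m j : Fin l.length), m ≠ j →
    ∃ W : List α, (l.eraseIdx m).Perm (l.get j :: W) ∧ (l.eraseIdx j).Perm (l.get m :: W) ∧
      (∀ x ∈ W, x ∈ l) ∧ W.length + 2 = l.length
  | [], m, _, _ => m.elim0
  | a :: l, ⟨0, hm⟩, ⟨0, hj⟩, hne => absurd rfl hne
  | a :: l, ⟨0, hm⟩, ⟨j + 1, hj⟩, _ => by
    have hj' : j < l.length := by simpa using hj
    have hlen : (l.eraseIdx j).length = l.length - 1 := by rw [List.length_eraseIdx]; simp [hj']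
    refine ⟨l.eraseIdx j, ?_, List.Perm.refl _, fun x hx => List.mem_cons_of_mem a (List.mem_of_mem_eraseIdx hx), ?_⟩
    · exact perm_get_cons_eraseIdx l ⟨j, hj'⟩
    · rw [hlen, List.length_cons]; omega
  | a :: l, ⟨m + 1, hm⟩, ⟨0, hj⟩, _ => by
    have hm' : m < l.length := by simpa using hm
    have hlen : (l.eraseIdx m).length = l.length - 1 := by rw [List.length_eraseIdx]; simp [hm']
    refine ⟨l.eraseIdx m, List.Perm.refl _, ?_, fun x hx => List.mem_cons_of_mem a (List.mem_of_mem_eraseIdx hx), ?_⟩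
    · exact perm_get_cons_eraseIdx l ⟨m, hm'⟩
    · rw [hlen, List.length_cons]; omega
  | a :: l, ⟨m + 1, hm⟩, ⟨j + 1, hj⟩, hne => by
    have hm' : m < l.length := by simpa using hm
    have hj' : j < l.length := by simpa using hj
    have hne' : (⟨m, hm'⟩ : Fin l.length) ≠ ⟨j, hj'⟩ := by
      intro h
      apply hne
      simp only [Fin.mk.injEq] at h ⊢
      omega
    obtain ⟨W, h1, h2, h3, h4⟩ := exists_common_remainder l ⟨m, hm'⟩ ⟨j, hj'⟩ hne'
    refine ⟨a :: W, ?_, ?_, ?_, ?_⟩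
    · show (a :: l.eraseIdx m).Perm (l.get ⟨j, hj'⟩ :: a :: W)
      exact (h1.cons a).trans (List.Perm.swap _ _ _)
    · show (a :: l.eraseIdx j).Perm (l.get ⟨m, hm'⟩ :: a :: W)
      exact (h2.cons a).trans (List.Perm.swap _ _ _)
    · intro x hx
      rcases List.mem_cons.1 hx with rfl | hx
      · exact List.mem_cons_self
      · exact List.mem_cons_of_mem a (h3 x hx)
    · rw [List.length_cons, List.length_cons]; omega

end LawDec
end Quant
end Summit.CriticalPhenomena.PercolationContinuityZ3.Theorems
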